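import Summits.HubbardSuperconductivity.HubbardSuperconductivity.Theorems.ThermalWedgeTwTipContinuationEdgeOrderTuning
import Literature.MathematicalPhysics.QuantumLattice.TorusBandEdgeCounting

/-!
# `DeformedRung` (stmt-HubbardSuperconductivity-1894, route `DeformationLadder`) — piece 2:
# tuning the chemical potential of the BCS trial state at EVERY filling below one, every side `L`

The mean particle number of the regularised d-wave BCS trial state,
`N̄_L(μ) = Σ_k (1 − (ε_L(k) − μ)/√((ε_L(k) − μ)² + D²ĝ_d(k)² + D⁴))`, is continuous in `μ`
(`continuous_occSum`). Below: `N̄_L(−15/4 − 4D) ≤ (9/32)L² + 2L + 8` (band-bottom level count,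
exactly as in `exists_mu_of_target`); above, at a slightly POSITIVE ceiling `β > 0`:
`N̄_L(β) ≥ (2 − 10D²/β²) · #{ε_L ≤ β/4} ≥ (2 − η)(L − 2)²/2` by the lattice diamond below every
positive level (`two_mul_sq_le_card_filter_torusBand_lt` of `TorusBandEdgeCounting`, valid for EVERY
parity of `L` — no `(π,π)` symmetry), once `10D² ≤ ηβ²`. Hence every target
`t ∈ [L²/2 − 2KL − 2, (1 − η)L²]` — in particular `2⌊(1−δ)L²/2⌋ − 2KL` for ANY `δ ∈ (0,1/2)` with
`η = δ` — is attained at some `μ ∈ [−15/4 − 4D, β]` once `L ≥ L₀(K, η)` (`exists_mu_of_target_all`).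
Folklore bookkeeping (intermediate value theorem).
-/

noncomputable section

namespace Summit.HubbardSuperconductivity.DeformationLadder.DeformedRung

open Finset Real
open Literature.MathematicalPhysics.QuantumLattice Literature.Probability.LatticeModels
open Summit.HubbardSuperconductivity.TwTipContinuation.IsogapTransport

variable {L : ℕ} [NeZero L]

/-- **Half the torus lies below every positive level**, every parity of `L`:
`(L − 2)²/2 ≤ #{k : ε_L(k) ≤ β}` for `β > 0`, `L ≥ 2` (the lattice diamond
`m(k₀) + m(k₁) ≤ (L−1)/2` of folded indices has `ε_L ≤ 0 < β`). [folklore] -/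
theorem sq_sub_two_le_torusLevelCount_of_pos {β : ℝ} (hβ : 0 < β) (hL : 2 ≤ L) :
    ((L : ℝ) - 2) ^ 2 / 2 ≤ torusLevelCount L β := by
  set M : ℕ := (L - 1) / 2 with hM
  have h2M : 2 * M < L := by omega
  have hcos : -4 * Real.cos (π * M / L) ^ 2 < β := by
    have : 0 ≤ Real.cos (π * M / L) ^ 2 := sq_nonneg _
    linarith
  have hcnt := two_mul_sq_le_card_filter_torusBand_lt h2M hcos
  have hmono : (Finset.univ.filter fun k : TorusSite 2 L => torusBand L k < β).card ≤ torusLevelCount L β := by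
    rw [torusLevelCount_def]
    exact Finset.card_le_card fun k hk => by
      rw [Finset.mem_filter] at hk ⊢
      exact ⟨hk.1, hk.2.le⟩
  have hMr : ((L : ℝ) - 2) / 2 ≤ M := by
    have h' : L - 2 ≤ 2 * M := by omega
    have h'' : ((L - 2 : ℕ) : ℝ) ≤ ((2 * M : ℕ) : ℝ) := by exact_mod_cast h'
    rw [Nat.cast_sub hL] at h''
    push_cast at h''
    linarith
  have hL2 : (0 : ℝ) ≤ ((L : ℝ) - 2) / 2 := by
    have : (2 : ℝ) ≤ L := by exact_mod_cast hL
    linarith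
  calc ((L : ℝ) - 2) ^ 2 / 2 = 2 * (((L : ℝ) - 2) / 2) ^ 2 := by ring
    _ ≤ 2 * (M : ℝ) ^ 2 := by gcongr
    _ = ((2 * M ^ 2 : ℕ) : ℝ) := by push_cast; ring
    _ ≤ ((Finset.univ.filter fun k : TorusSite 2 L => torusBand L k < β).card : ℝ) := by exact_mod_cast hcnt
    _ ≤ torusLevelCount L β := by exact_mod_cast hmono

omit [NeZero L] in
/-- **Tuning the chemical potential at every filling below one (piece 2 of `DeformedRung`).** For
`0 < D ≤ 1`, a ceiling `β > 0`, a deficit `η ∈ (0,1]` with `10D² ≤ ηβ²`, and `K ≥ 0`, there is `L₀`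
such that for all `L ≥ L₀` (every parity) every target `t ∈ [L²/2 − 2KL − 2, (1 − η)L²]` is the mean
number of the regularised BCS trial state at some `μ ∈ [−15/4 − 4D, β]`:
`Σ_k (1 − (ε_L(k) − μ)/√((ε_L(k) − μ)² + D²ĝ_d(k)² + D⁴)) = t`. [folklore] -/
theorem exists_mu_of_target_all {D β η K : ℝ} (hD : 0 < D) (hD1 : D ≤ 1) (hβ : 0 < β)
    (hη : 0 < η) (hη1 : η ≤ 1) (hDβ : 10 * D ^ 2 ≤ η * β ^ 2) (hK : 0 ≤ K) :
    ∃ L₀ : ℕ, ∀ (L : ℕ) [NeZero L], L₀ ≤ L → ∀ t : ℝ, (L : ℝ) ^ 2 / 2 - 2 * K * L - 2 ≤ t →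
      t ≤ (1 - η) * (L : ℝ) ^ 2 →
      ∃ μ : ℝ, -15 / 4 - 4 * D ≤ μ ∧ μ ≤ β ∧ ∑ k : TorusSite 2 L,
        (1 - (torusBand L k - μ) / Real.sqrt ((torusBand L k - μ) ^ 2 + D ^ 2 * dWaveGap k ^ 2 + D ^ 4)) = t := by
  refine ⟨⌈16 * K⌉₊ + ⌈8 / η⌉₊ + 32, fun L _ hL t ht1 ht2 => ?_⟩
  have hLK : 16 * K + 8 / η + 32 ≤ (L : ℝ) := by
    have h1 : ((⌈16 * K⌉₊ + ⌈8 / η⌉₊ + 32 : ℕ) : ℝ) ≤ L := by exact_mod_cast hL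
    push_cast at h1
    have h2 : 16 * K ≤ (⌈16 * K⌉₊ : ℝ) := Nat.le_ceil _
    have h3 : 8 / η ≤ (⌈8 / η⌉₊ : ℝ) := Nat.le_ceil _
    linarith
  have h8η : 0 < 8 / η := by positivity
  have hL32 : (32 : ℝ) ≤ L := by nlinarith
  have hLnat : 2 ≤ L := by exact_mod_cast (show (2 : ℝ) ≤ L by linarith)
  have hηL : 8 ≤ η * L := by
    have h := (div_le_iff₀ hη).1 (show 8 / η ≤ (L : ℝ) by nlinarith)
    linarith
  have hLK' : 16 * K + 32 ≤ (L : ℝ) := by linarith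
  set a : ℝ := -15 / 4 - 4 * D with ha
  set f : ℝ → ℝ := fun μ => ∑ k : TorusSite 2 L,
    (1 - (torusBand L k - μ) / Real.sqrt ((torusBand L k - μ) ^ 2 + D ^ 2 * dWaveGap k ^ 2 + D ^ 4)) with hf
  have hcont : Continuous f := continuous_occSum hD
  have hD2 : D ^ 2 ≤ 1 := by nlinarith
  -- `f a ≤ t`
  have hfa : f a ≤ t := by
    have hτ : (0 : ℝ) < 4 * D := by positivity
    have hfrac : (4 * D ^ 2 + D ^ 4) / (2 * (4 * D) ^ 2) ≤ 5 / 32 := by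
      rw [div_le_div_iff₀ (by positivity) (by norm_num)]
      nlinarith [sq_nonneg D]
    have h1 := occSum_le (L := L) a hτ hD
    have hlev := torusLevelCount_bottom_le (L := L) (s := 1 / 2) (by norm_num)
    have e : a + 4 * D = -4 + (1 / 2 : ℝ) ^ 2 := by rw [ha]; norm_num
    rw [e] at h1
    have h2 : (L : ℝ) ^ 2 * ((4 * D ^ 2 + D ^ 4) / (2 * (4 * D) ^ 2)) ≤ (L : ℝ) ^ 2 * (5 / 32) :=
      mul_le_mul_of_nonneg_left hfrac (by positivity)
    have h3 : f a ≤ 2 * ((1 / 2 * L / 2 + 2) ^ 2) + (L : ℝ) ^ 2 * (5 / 32) := by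
      calc f a ≤ 2 * (torusLevelCount L (-4 + (1 / 2 : ℝ) ^ 2) : ℝ) +
            (L : ℝ) ^ 2 * ((4 * D ^ 2 + D ^ 4) / (2 * (4 * D) ^ 2)) := h1
        _ ≤ _ := by gcongr
    have hprod : 0 ≤ ((L : ℝ) - 16 * K - 32) * L := mul_nonneg (by linarith) (Nat.cast_nonneg L)
    nlinarith
  -- `t ≤ f β`
  have hfb : t ≤ f β := by
    have hτ : (0 : ℝ) < β / 2 := by positivity
    have hE : β / 4 + β / 2 < β := by linarith
    have h1 := le_occSum (L := L) β hτ hE hD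
    have hlev := sq_sub_two_le_torusLevelCount_of_pos (L := L) (by positivity : (0 : ℝ) < β / 4) hLnat
    have hfrac : (4 * D ^ 2 + D ^ 4) / (2 * (β / 2) ^ 2) ≤ η := by
      rw [div_le_iff₀ (by positivity)]
      have : D ^ 4 ≤ D ^ 2 := by nlinarith [sq_nonneg D]
      nlinarith
    have hcnt0 : (0 : ℝ) ≤ torusLevelCount L (β / 4) := Nat.cast_nonneg _
    have h2η : 0 ≤ 2 - η := by linarith
    have h2 : (2 - η) * (((L : ℝ) - 2) ^ 2 / 2) ≤ f β :=
      calc (2 - η) * (((L : ℝ) - 2) ^ 2 / 2) ≤ (2 - η) * (torusLevelCount L (β / 4) : ℝ) :=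
            mul_le_mul_of_nonneg_left hlev h2η
        _ ≤ (2 - (4 * D ^ 2 + D ^ 4) / (2 * (β / 2) ^ 2)) * (torusLevelCount L (β / 4) : ℝ) :=
            mul_le_mul_of_nonneg_right (by linarith) hcnt0
        _ ≤ f β := h1
    have hprod : 0 ≤ (η * L - 8) * (L : ℝ) := mul_nonneg (by linarith) (Nat.cast_nonneg L)
    nlinarith
  -- intermediate value theorem on `[a, β]`
  have hab : a ≤ β := by rw [ha]; linarith
  obtain ⟨μ, hμ, hfμ⟩ := intermediate_value_Icc hab hcont.continuousOn ⟨hfa, hfb⟩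
  exact ⟨μ, hμ.1, hμ.2, hfμ⟩

end Summit.HubbardSuperconductivity.DeformationLadder.DeformedRung
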